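import Literature.NumberTheory.EllipticCurves.HeckeGrossencharakterFunctionalEquation
import Literature.NumberTheory.EllipticCurves.HeckeGrossencharakterFunctionalEquationHolds
import HarnessLib

/-!
# The root number `W(φρ) ∈ {1, −1}` of an anticyclotomic twist of a type-`(1,0)` Größencharakter of an imaginary quadratic field —
# DISCHARGED: `hecke_centralRootNumber_anticyclotomicTwists_holds`

Kernel-lane companion of ★ `Literature/NumberTheory/EllipticCurves/RohrlichAnticyclotomicRootNumber.lean`: its named fact
★ `hecke_centralRootNumber_anticyclotomicTwists` (Hecke's functional equation `Λ(s, φρ) = W(φρ) Λ(2 − s, φρ)` with `W(φρ) = ±1`, for `φ` of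
infinity type `(1, 0)` conjugation-equivariant and `ρ` of finite order anticyclotomic; [Jia2026ActaArith] §1–§2 (3)–(6),
[Rohrlich1984Anticyclotomic] (6)–(7)) is PROVED here by composing two tree theorems:

* ★ `Hecke_functionalEquation_infinityType_holds : Hecke_functionalEquation_infinityType`
  (`HeckeGrossencharakterFunctionalEquationHolds.lean`: Hecke's functional equation for Größencharaktere of type `(m, 0)`, from the proved
  conductor-pinned form — Hecke's theta integral), and
* ★ `Hecke_functionalEquation_infinityType.hecke_centralRootNumber_anticyclotomicTwists_of_infinityType`
  (`HeckeGrossencharakterFunctionalEquation.lean`: `φρ` is again conjugation-equivariant of type `(1, 0)`, so its root number is `±1`).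

The def's docstring sentence «No `_holds` (Hecke's theta integral … is not in the tree)» is thereby superseded.  THEOREMS ONLY (no
definition, no named fact, no `sorry`, no instance, no notation); seat B-typ01 (g33) of cell hodgecm-mathlib (off-rota Literature
discharges); net debt −1.

## References
* [Jia2026ActaArith] §1 and §2 (3)–(6) (the functional equation `Λ(s,χ) = W(χ)Λ(2−s,χ)`, `W(χ) = ±1`).
* [Rohrlich1984Anticyclotomic] D. Rohrlich, *On `L`-functions of elliptic curves and anticyclotomic towers*, Invent. Math. 75 (1984), (6)–(7).
* [NeukirchANT1999] J. Neukirch, *Algebraic Number Theory*, Ch. VII §8 Thm. (8.5), Cor. (8.6).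
-/

namespace Literature.NumberTheory.EllipticCurves

/-- ★ `hecke_centralRootNumber_anticyclotomicTwists` HOLDS: for `K` imaginary quadratic, `φ` a Hecke character of infinity type `(1, 0)` with
`φ ∘ c = φ̄`, and `ρ` of finite order anticyclotomic, `Λ(s, φρ)` is entire with `Λ(s) = W Λ(2 − s)`, `W = 1` or `W = −1` — Hecke's functional
equation (★ `Hecke_functionalEquation_infinityType_holds`) applied to `φρ` (★ `hecke_centralRootNumber_anticyclotomicTwists_of_infinityType`).
[cite: Jia2026ActaArith, §1 and §2 (3)–(6)] [cite: Rohrlich1984Anticyclotomic, (6)–(7)] [cite: NeukirchANT1999, Ch. VII §8 Thm. (8.5), Cor. (8.6)] -/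
theorem hecke_centralRootNumber_anticyclotomicTwists_holds : hecke_centralRootNumber_anticyclotomicTwists :=
  Hecke_functionalEquation_infinityType.hecke_centralRootNumber_anticyclotomicTwists_of_infinityType
    Hecke_functionalEquation_infinityType_holds

end Literature.NumberTheory.EllipticCurves
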